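import Literature.MathematicalPhysics.QuantumFieldTheory.MullerSchiemann1987.MS87MigdalRecursion
import Literature.LinearAlgebra.Matrix.SpecialUnitaryGroupConjugacyClasses
import Mathlib.LinearAlgebra.Matrix.Charpoly.Coeff
import HarnessLib

/-!
# Müller–Schiemann, *Continuum limit of a hierarchical SU(2) lattice gauge theory in 4 dimensions*
# (CMP 110, 1987), (2.16)–(2.17) p.265 from (2.2) p.263: a class function on `SU(2)` is a function of the central
# angle — «g̃⁽ⁿ⁾(u, x) = g⁽ⁿ⁾(e^{−ixσ₃}u) = g⁽ⁿ⁾(e^{−iθσ₃}) = h⁽ⁿ⁾(θ) (2.16) with the central angle θ … given by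
# cos θ = u₀ cos x + u₃ sin x (2.17)» — PROVED via the conjugacy classes of `SU(2)` (theorems only; no definition, no fact)

statement-level skeleton of published theorems with citation tags; proofs where landed; nothing here is a claim about the Yang–Mills mass gap

**Citation header (reproduction of PUBLISHED work).** V. F. Müller, J. Schiemann, *Continuum limit of a hierarchical
SU(2) lattice gauge theory in 4 dimensions*, Commun. Math. Phys. **110** (1987) 261–286, doi 10.1007/BF01207367
[MullerSchiemann1987]; (2.2) p.263, (2.10)–(2.12) p.264, Proof of Proposition 1 p.265 L.9–13 with (2.16)–(2.17) (held
Project Euclid scan `paper:url-96df5da18d4c`; displays read by this seat on its own 3× page renders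
`run/shared/lean/pub/lit-balaban/lit-balaban-p12/renders-cmp110ms/ms87-cmp110-pdfp003,004,005-journalp263,264,265-
x3.png`). Conjugacy classes of `SU(n)`: Th. Bröcker, T. tom Dieck, *Representations of Compact Lie Groups* (1985)
IV (2.5)–(2.6) as formalized in the tree's `Literature.LinearAlgebra.Matrix.SpecialUnitaryGroupConjugacyClasses`
(`isConj_iff_charpoly_eq_su`). Lean lane of the lit-balaban YM LIT SWEEP CONTEXT row X1 (register level; zero weight
for any token of that table); the model is the `d = 4` HIERARCHICAL `SU(2)` gauge model, NOT lattice Yang–Mills.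

**What the paper prints.** (2.2) p.263: *«g⁽ⁿ⁾(vuv⁻¹) = g⁽ⁿ⁾(u)»*; p.265 L.9–13 (Proof of Proposition 1): *«Since the
Gibbs factors are class functions, (2.2), we have for x ∈ ℝ, g̃⁽ⁿ⁾(u, x) = g⁽ⁿ⁾(e^{−ixσ₃}u) = g⁽ⁿ⁾(e^{−iθσ₃}) =
h⁽ⁿ⁾(θ) (2.16) with the central angle θ and its complement θ̌ = π − θ given by cos θ = u₀ cos x + u₃ sin x = −cos θ̌.
(2.17)»*; (2.10)–(2.12) p.264: `h(z) := g̃(e₀, z)`, `h(z + 2π) = h(z)`, `h(−z) = h(z)`.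

**What this file proves (kernel-checked, 0 sorry, standard axioms; no definition, no named fact).** `u₀, u₃, e^{−ixσ₃}`
are the sibling `MS87HeatKernelGroup`'s `HeatKernel.u0/u3/diagPhase`; «class function» is the hypothesis
`∀ u v, g(vuv⁻¹) = g(u)` (the sibling `Migdal.IsCentral` for real `g`), values in any type `Y`.
* §1 **conjugacy classes of `SU(2)` are the level sets of `u₀`**: `tr u = 2u₀` (`trace_eq_two_mul_u0`, the tree's
  `su2_apply_11`), the characteristic polynomial is `X² − 2u₀X + 1` (`charpoly_eq`, Mathlib's `Matrix.charpoly_fin_two`),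
  so `u₀(u) = u₀(u′) ⟹ u ∼ u′` in `SU(2)` (`isConj_of_u0_eq`, via the tree's `isConj_iff_charpoly_eq_su`) and conversely
  (`u0_eq_of_isConj`, `u0_conj`).
* §2 **(2.2) ⟹ `g` is a function of `u₀` alone** (`central_apply_eq_of_u0_eq`).
* §3 **(2.16)–(2.17)**: `g(u) = g(e^{−iθσ₃})` for every `θ` with `cos θ = u₀(u)` (`eq216`), in particular for the
  central angle `θ = arccos u₀(u)` (`eq216_arccos`); `g̃(u, x) = g(e^{−ixσ₃}u) = g(e^{−iθσ₃})` for every `θ` with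
  `cos θ = u₀ cos x + u₃ sin x` (`eq216_eq217`, with the sibling's (2.17) `u0_diagPhase_mul`).
* §4 the angular representative `h(θ) := g(e^{−iθσ₃})` is EVEN and `2π`-PERIODIC ((2.11)–(2.12): `angular_even`,
  `angular_periodic`), continuous when `g` is (`continuous_angular`, `continuous_diagPhase`), and **`g = h ∘ arccos ∘ u₀`**
  (`exists_angular`; for the real Gibbs factors `gibbs_eq_angular` — the hypothesis `hgh` of the sibling
  `Theorem3CommonSubsequence.theorem3` with `θ = arccos ∘ u₀`, DERIVED from (2.2)).

**Readings / scope (declared).** (i) Only real angles: the analytic continuation `g̃(u, z)` in `z` ((2.6)–(2.7)) is the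
siblings' business (`MS87HeatKernelGroup`, `MS87Theorem3Continuation`). (ii) The complement angle `θ̌ = π − θ` of (2.17)
is not needed here (`g(e^{−iθσ₃})` with ANY `θ` solving `cos θ = u₀` is covered by `eq216`).

**Not claimed.** Proposition 1 (the continued central angle `θ(u, z)`), anything about lattice Yang–Mills or the Clay
problem.
-/

noncomputable section

open Polynomial

namespace Literature.MathematicalPhysics.QuantumFieldTheory

namespace MullerSchiemann1987

namespace ClassFunctionsSU2

open HeatKernel (u0 u3 diagPhase u0_one u3_one u0_diagPhase_mul abs_u0_le_one continuous_u0)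
open Literature.MathematicalPhysics.QuantumLattice (su2_apply_11)
open Literature.LinearAlgebra.Matrix (isConj_iff_charpoly_eq_su)

/-! ## §1 The characteristic polynomial of `u ∈ SU(2)` is `X² − 2u₀X + 1`: conjugacy classes are the level sets of `u₀` -/

/-- `tr u = 2u₀` on `SU(2)` (`u₁₁ = conj u₀₀`). [cite: MullerSchiemann1987, (2.2) p.263, (2.17) p.265] -/
theorem trace_eq_two_mul_u0 (U : Matrix.specialUnitaryGroup (Fin 2) ℂ) :
    Matrix.trace (U : Matrix (Fin 2) (Fin 2) ℂ) = 2 * (u0 U : ℂ) := by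
  rw [Matrix.trace_fin_two, su2_apply_11, u0]
  apply Complex.ext
  · simp; ring
  · simp

/-- The characteristic polynomial of `u ∈ SU(2)`: `X² − 2u₀·X + 1`. [cite: MullerSchiemann1987, (2.17) p.265] -/
theorem charpoly_eq (U : Matrix.specialUnitaryGroup (Fin 2) ℂ) :
    (U : Matrix (Fin 2) (Fin 2) ℂ).charpoly = X ^ 2 - C (2 * (u0 U : ℂ)) * X + 1 := by
  rw [Matrix.charpoly_fin_two, trace_eq_two_mul_u0, (Matrix.mem_specialUnitaryGroup_iff.mp U.2).2, map_one]

/-- **Two elements of `SU(2)` with the same `u₀` are conjugate in `SU(2)`** (same characteristic polynomial; the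
tree's `isConj_iff_charpoly_eq_su`). [cite: MullerSchiemann1987, (2.2) p.263, (2.16)–(2.17) p.265] -/
theorem isConj_of_u0_eq {U U' : Matrix.specialUnitaryGroup (Fin 2) ℂ} (h : u0 U = u0 U') : IsConj U U' := by
  rw [isConj_iff_charpoly_eq_su, charpoly_eq, charpoly_eq, h]

/-- Conversely conjugate elements have the same `u₀`. [cite: MullerSchiemann1987, (2.2) p.263] -/
theorem u0_eq_of_isConj {U U' : Matrix.specialUnitaryGroup (Fin 2) ℂ} (h : IsConj U U') : u0 U = u0 U' := by
  have h1 := (isConj_iff_charpoly_eq_su U U').mp h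
  rw [charpoly_eq, charpoly_eq] at h1
  have h2 := congrArg (fun p : ℂ[X] => p.coeff 1) h1
  simp only [coeff_add, coeff_sub, coeff_C_mul, coeff_X_pow, coeff_X_one, coeff_one] at h2
  norm_num at h2
  exact_mod_cast h2

/-- `u₀(vuv⁻¹) = u₀(u)`. [cite: MullerSchiemann1987, (2.2) p.263] -/
theorem u0_conj (U V : Matrix.specialUnitaryGroup (Fin 2) ℂ) : u0 (V * U * V⁻¹) = u0 U :=
  (u0_eq_of_isConj (isConj_iff.mpr ⟨V, rfl⟩)).symm

/-! ## §2 (2.2) ⟹ a class function on `SU(2)` is a function of `u₀` alone -/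

/-- **A class function on `SU(2)` depends only on `u₀`**: if `g(vuv⁻¹) = g(u)` ((2.2)) then `u₀(u) = u₀(u′)` implies
`g(u) = g(u′)`. [cite: MullerSchiemann1987, (2.2) p.263, (2.16) p.265] -/
theorem central_apply_eq_of_u0_eq {Y : Type*} {g : Matrix.specialUnitaryGroup (Fin 2) ℂ → Y}
    (hg : ∀ u v : Matrix.specialUnitaryGroup (Fin 2) ℂ, g (v * u * v⁻¹) = g u)
    {U U' : Matrix.specialUnitaryGroup (Fin 2) ℂ} (h : u0 U = u0 U') : g U = g U' := by
  obtain ⟨V, hV⟩ := isConj_iff.mp (isConj_of_u0_eq h)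
  rw [← hV, hg]

/-! ## §3 (2.16)–(2.17): `g(u) = g(e^{−iθσ₃}) = h(θ)` with `cos θ = u₀`, and `g̃(u, x) = g(e^{−ixσ₃}u) = h(θ)` with
`cos θ = u₀ cos x + u₃ sin x` -/

/-- `u₀(e^{−ixσ₃}) = cos x`. [cite: MullerSchiemann1987, (2.17) p.265] -/
private theorem u0_diagPhase' (x : ℝ) : u0 (diagPhase x) = Real.cos x := by
  have := u0_diagPhase_mul x 1
  rw [mul_one, u0_one, u3_one] at this
  rw [this]; ring

/-- **(2.16) at `x = 0`**: for a class function `g` on `SU(2)` and any `θ` with `cos θ = u₀(u)`,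
`g(u) = g(e^{−iθσ₃})`. [cite: MullerSchiemann1987, (2.16)–(2.17) p.265] -/
theorem eq216 {Y : Type*} {g : Matrix.specialUnitaryGroup (Fin 2) ℂ → Y}
    (hg : ∀ u v : Matrix.specialUnitaryGroup (Fin 2) ℂ, g (v * u * v⁻¹) = g u)
    (U : Matrix.specialUnitaryGroup (Fin 2) ℂ) {θ : ℝ} (hθ : Real.cos θ = u0 U) : g U = g (diagPhase θ) :=
  central_apply_eq_of_u0_eq hg (by rw [u0_diagPhase', hθ])

/-- **(2.16) with the central angle `θ = arccos u₀(u) ∈ [0, π]`**: `g(u) = g(e^{−i·arccos(u₀(u))·σ₃})`.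
[cite: MullerSchiemann1987, (2.16)–(2.17) p.265] -/
theorem eq216_arccos {Y : Type*} {g : Matrix.specialUnitaryGroup (Fin 2) ℂ → Y}
    (hg : ∀ u v : Matrix.specialUnitaryGroup (Fin 2) ℂ, g (v * u * v⁻¹) = g u)
    (U : Matrix.specialUnitaryGroup (Fin 2) ℂ) : g U = g (diagPhase (Real.arccos (u0 U))) := by
  have h := abs_le.mp (abs_u0_le_one U)
  exact eq216 hg U (Real.cos_arccos h.1 h.2)

/-- **(2.16)–(2.17) for real `x`**: `g̃(u, x) = g(e^{−ixσ₃}u) = g(e^{−iθσ₃})` for every `θ` with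
`cos θ = u₀ cos x + u₃ sin x`. [cite: MullerSchiemann1987, (2.16)–(2.17) p.265] -/
theorem eq216_eq217 {Y : Type*} {g : Matrix.specialUnitaryGroup (Fin 2) ℂ → Y}
    (hg : ∀ u v : Matrix.specialUnitaryGroup (Fin 2) ℂ, g (v * u * v⁻¹) = g u)
    (x : ℝ) (U : Matrix.specialUnitaryGroup (Fin 2) ℂ) {θ : ℝ} (hθ : Real.cos θ = u0 U * Real.cos x + u3 U * Real.sin x) :
    g (diagPhase x * U) = g (diagPhase θ) :=
  eq216 hg (diagPhase x * U) (by rw [u0_diagPhase_mul, hθ])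

/-! ## §4 The angular representative `h(θ) := g(e^{−iθσ₃})` ((2.10)/(2.16)): even, `2π`-periodic, continuous, and
`g = h ∘ arccos ∘ u₀` -/

/-- `h(θ) := g(e^{−iθσ₃})` is EVEN ((2.12)): `u₀(e^{iθσ₃}) = u₀(e^{−iθσ₃}) = cos θ` and `g` is a class function.
[cite: MullerSchiemann1987, (2.12) p.264, (2.16) p.265] -/
theorem angular_even {Y : Type*} {g : Matrix.specialUnitaryGroup (Fin 2) ℂ → Y}
    (hg : ∀ u v : Matrix.specialUnitaryGroup (Fin 2) ℂ, g (v * u * v⁻¹) = g u) (θ : ℝ) :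
    g (diagPhase (-θ)) = g (diagPhase θ) :=
  central_apply_eq_of_u0_eq hg (by rw [u0_diagPhase', u0_diagPhase', Real.cos_neg])

/-- `h(θ) := g(e^{−iθσ₃})` is `2π`-PERIODIC ((2.11)). [cite: MullerSchiemann1987, (2.11) p.264, (2.16) p.265] -/
theorem angular_periodic {Y : Type*} {g : Matrix.specialUnitaryGroup (Fin 2) ℂ → Y}
    (hg : ∀ u v : Matrix.specialUnitaryGroup (Fin 2) ℂ, g (v * u * v⁻¹) = g u) (θ : ℝ) :
    g (diagPhase (θ + 2 * Real.pi)) = g (diagPhase θ) :=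
  central_apply_eq_of_u0_eq hg (by rw [u0_diagPhase', u0_diagPhase', Real.cos_add_two_pi])

/-- The one-parameter subgroup `x ↦ e^{−ixσ₃}` is continuous. [cite: MullerSchiemann1987, (2.6) p.264] -/
theorem continuous_diagPhase : Continuous (diagPhase : ℝ → Matrix.specialUnitaryGroup (Fin 2) ℂ) := by
  refine Continuous.subtype_mk ?_ _
  refine continuous_pi fun i => continuous_pi fun j => ?_
  fin_cases i <;> fin_cases j
  · show Continuous fun x : ℝ => Complex.exp (((-x : ℝ) : ℂ) * Complex.I)
    fun_prop
  · exact continuous_const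
  · exact continuous_const
  · show Continuous fun x : ℝ => Complex.exp ((x : ℂ) * Complex.I)
    fun_prop

/-- `h = g ∘ e^{−i·σ₃}` is continuous when `g` is. [cite: MullerSchiemann1987, (2.16) p.265] -/
theorem continuous_angular {Y : Type*} [TopologicalSpace Y] {g : Matrix.specialUnitaryGroup (Fin 2) ℂ → Y}
    (hc : Continuous g) : Continuous fun θ : ℝ => g (diagPhase θ) :=
  hc.comp continuous_diagPhase

/-- **(2.16) assembled**: a class function `g` on `SU(2)` is `h ∘ arccos ∘ u₀` with `h(θ) = g(e^{−iθσ₃})` even and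
`2π`-periodic — the form `g = h ∘ θ` in which the siblings `Theorem3CommonSubsequence.theorem3` (hypothesis `hgh`) and
`MS87ConjugacyClassNull` take the Gibbs factors. [cite: MullerSchiemann1987, (2.16)–(2.17) p.265, (2.11)–(2.12) p.264] -/
theorem exists_angular {Y : Type*} {g : Matrix.specialUnitaryGroup (Fin 2) ℂ → Y}
    (hg : ∀ u v : Matrix.specialUnitaryGroup (Fin 2) ℂ, g (v * u * v⁻¹) = g u) :
    ∃ h : ℝ → Y, (∀ θ, h (-θ) = h θ) ∧ (∀ θ, h (θ + 2 * Real.pi) = h θ) ∧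
      (∀ U, g U = h (Real.arccos (u0 U))) ∧ ∀ θ, h θ = g (diagPhase θ) :=
  ⟨fun θ => g (diagPhase θ), angular_even hg, angular_periodic hg, eq216_arccos hg, fun _ => rfl⟩

/-- The real Gibbs factors of the paper ((2.2) = the sibling's `Migdal.IsCentral`): `g(u) = h(arccos u₀(u))` with
`h(θ) = g(e^{−iθσ₃})`, as complex numbers — the hypothesis `hgh` of `Theorem3CommonSubsequence.theorem3` with
`θ = arccos ∘ u₀`, for the angular representative restricted to real angles. [cite: MullerSchiemann1987, (2.16) p.265] -/
theorem gibbs_eq_angular {g : Matrix.specialUnitaryGroup (Fin 2) ℂ → ℝ} (hg : Migdal.IsCentral g)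
    (U : Matrix.specialUnitaryGroup (Fin 2) ℂ) :
    (g U : ℂ) = ((fun θ : ℝ => (g (diagPhase θ) : ℂ)) (Real.arccos (u0 U))) := by
  rw [eq216_arccos hg U]

end ClassFunctionsSU2

end MullerSchiemann1987

end Literature.MathematicalPhysics.QuantumFieldTheory
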